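import Summits.ABC.IUTFork.Repair.RLana91OrderVariant
import Summits.ABC.IUTFork.Repair.RLana91ArchCorner
import HarnessLib

/-!
# REPAIR-CATALOGUE row RC-667 (LANA-family ORDER variant «−|log q| ≤ log-vol of SOME global possible image», `Repair.RLana91OrderVariant.OrderVariant`)
# at the HONEST-ARCHIMEDEAN genuine sharp bed: ⟺ the SHALLOW regime `((l+1)/24 − 1/(2l))·deĝ̲(𝔮) ≤ ((l+5)/4)·log π` ⟺ TEAM B's input —
# a DATA-DEPENDENT verdict (D-0123 (C); seat abc-iut-rcat-tst-9 gen 5; container-sensitivity record for catalogue v1.8 caveat (b))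

PROOF-ONLY file (D-0012; no definition, no `Prop` fact; class `Lana`, rows RC-667 / RC-130; rung LADDER-ABC:A2; companion of
`Repair.RLana91ContainerGrain` / `Repair.RLana91ArchCorner`). TAKES NO SIDE on [IUTchIII] Cor. 3.12 / [IUTchIV] Thm. 1.10, on the LANA authors, or
on any author or repository; nothing here asserts abc proved or refuted; REFUTED-AS-TYPED ≠ refuted-in-print; HOLDS-AS-TYPED ≠ holds-in-print.
Row RC-667's kernel word of record (this seat gen 2, `RLana91OrderVariant`, p518887): the order variant is strictly between the printed `Statement`
and (9-1) as typed, KILLED at CM (`not_orderVariant_pinned`) and at the genuine sharp bed (`not_orderVariant_settingPrVolSharp`) — the latter a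
TRIVIAL-`∞`-corner word (abc-iut-c312-7's `settingPrVolSharp`). THIS FILE evaluates the same typed order variant at the same print-normalised
container WITH THE HONEST ARCHIMEDEAN PLACE (abc-iut-c312-7 gen 3's `settingPrVolArchSharp` over abc-iut-w5-d163's `∞`-model).

WHAT IS PROVED. `orderVariant_settingPrVolArchSharp_iff` — the order variant ⟺ `−deĝ̲(P_q) ≤ −deĝ̲_lgp(P_Θ) + 𝔼_j |S^±_{j+1}|·log π` (every global
possible image has that volume, `RLana91ArchCorner.processionNormalized_imageChoice_settingPrVolArchSharp`; `−|log q| = −deĝ̲(P_q)`);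
`orderVariant_settingPrVolArchSharp_iff_shallow` — ⟺ abc-iut-skel's SHALLOW regime `((l+1)/24 − 1/(2l))·deĝ̲(𝔮) ≤ archLogTheta l`
(abc-iut-w5-d241 `archCornerIneq_iff_shallow`); `orderVariant_settingPrVolArchSharp_iff_globalVolumeTransport` — ⟺ TEAM B's named input
`GlobalVolumeTransport` at this corner (abc-iut-c312-7 / w5-d241 `globalVolumeTransport_settingPrVolArchSharp_iff_shallow`): at the honest-`∞` bed
the LANA-family order variant over arbitrary possible images and the cell's own (xi-g) input over Kummer images are ONE predicate;
`orderVariant_settingPrVolArchSharp_of_shallow` / `not_orderVariant_settingPrVolArchSharp_of_deep` — the two regimes. BOTH regimes are INHABITED over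
every number field along one integer parameter (abc-iut-w5-d241 `shallow_pilotData_deepAt_crosses`: shallow at `(p, l, N) = (2, 5, 1)`, deep at
`(2, 5, 3)`), so the verdict is DATA-DEPENDENT.

READING for the catalogue (numbers and decl names, not adjectives; no side). Container-SENSITIVITY datum for RC-667: UNLIKE (9-1) itself
(`RLana91ArchCorner.not_H_settingPrVolArchSharp`: killed at BOTH corners, by the degree inequality resp. by the transcendence of `π`), the ORDER variant's
kill `not_orderVariant_settingPrVolSharp` (p518887) does NOT survive the passage to the honest archimedean container as a blanket word: there it
HOLDS-AS-TYPED exactly on SHALLOW pilot data and is KILLED exactly on DEEP pilot data — the archimedean Θ-term `(j+1)·log π` pays for the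
pilot-degree gap iff the Tate divisor is small. An inequality is not decided by Lindemann's theorem; the regime boundary itself is never attained
(`RLana91ArchCorner.kappa_mul_ndeg_qDivisor_ne_archLogTheta`). HONEST SCOPE: statements about OUR typed objects at OUR beds (volume-preserving
(Ind1)/(Ind2), (Ind3) absorbed in the sharp boxes, w5-d163's MODEL of the `∞`-boxes); the CM kill and the strictness words of p518887 are
toy-model / frame-level and stand; typed ≠ proved; instantiated ≠ endorsed.
[cite: LANA2026Report, §9.2 (9-1) p. 46; §9 p. 44; §10.5 p. 49] [cite: Mochizuki2012, IUTchIII Cor. 3.12 p. 173–174; proof Step (x) p. 181,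
Step (xi) p. 184] [cite: Mochizuki2012, IUTchIV Thm. 1.10 proof Step (vii) p. 30] [cite: DupuyHilado2025, Def. 3.1.1, §3.3, §3.4, Thm. 3.10.1]
[claim: Mochizuki2012, status: disputed] for every quoted construction.
-/

noncomputable section

open Set Function NumberField IsDedekindDomain

namespace Summit.ABC.IUTFork.Repair.RLana91OrderVariantArchCorner

open Thm311 Thm311.Real Cor312 Cor312Vol Literature.IUT.LogThetaLattice Literature.IUT.LogVolume Literature.IUT.HodgeTheaters
  Literature.NumberTheory.NumberFields RLana91OrderVariant RLana91ArchCorner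

section GenuineArch

variable {F : Type} [Field F] [NumberField F] (X : PilotData F) {logv : PadicLogs F} (hlog : LogvAnalytic logv)
  (hc : ∀ w : InfinitePlace F, w.IsComplex) (M : Type) [Field M] [NumberField M]
  (archPk : ∀ (j : (thetaIndex X).Label) (vQ : (thetaIndex X).VQ), Set ((logShellsDH X logv).Packet j vQ))
  (archSub : ∀ (j : (thetaIndex X).Label) (v : (thetaIndex X).V),
    Set ((logShellsDH X logv).Packet j ((thetaIndex X).over v)))
  (Ψ : ℤ → ∀ v : (thetaIndex X).V, v ∈ (thetaIndex X).Vbad → Set ((logShellsDH X logv).StarPacket v))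
  (act : ℤ → ∀ v : (thetaIndex X).V, v ∈ (thetaIndex X).Vbad →
    (logShellsDH X logv).StarPacket v → Module.End ℚ ((logShellsDH X logv).StarPacket v))
  (Mmod : ℤ → ∀ j : (thetaIndex X).LabelStar, Set ((logShellsDH X logv).GlobalPacket j.1))
  (region : ℤ → ∀ j : (thetaIndex X).LabelStar, FinDivisor M → ∀ vQ : (thetaIndex X).VQ,
    Set ((logShellsDH X logv).Packet j.1 vQ))
  (frobAdm : ℤ → ℤ → ∀ (j : (thetaIndex X).Label) (vQ : (thetaIndex X).VQ),
    Set ((logShellsDH X logv).Packet j vQ) → Prop)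
  (frobLogvol : ℤ → ℤ → ∀ (j : (thetaIndex X).Label) (vQ : (thetaIndex X).VQ),
    Set ((logShellsDH X logv).Packet j vQ) → ℝ)
  (frobΨ : ℤ → ℤ → ∀ v : (thetaIndex X).V, v ∈ (thetaIndex X).Vbad → Set ((logShellsDH X logv).StarPacket v))
  (frobMmod : ℤ → ℤ → ∀ j : (thetaIndex X).LabelStar, Set ((logShellsDH X logv).GlobalPacket j.1))
  (unitImage : ℤ → ℤ → ℕ → ∀ (j : (thetaIndex X).Label) (vQ : (thetaIndex X).VQ),
    Set ((logShellsDH X logv).Packet j vQ))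
  (ballImage : ℤ → ℤ → ∀ (j : (thetaIndex X).Label) (vQ : (thetaIndex X).VQ),
    Set ((logShellsDH X logv).Packet j vQ))
  (thetaDiv : ℤ → ℤ → LgpDivisor M (thetaIndex X).lstar)
  (n : ℤ) {HT : Type} {LogLink : HT → HT → Type} {IsFull : ∀ {s t : HT}, LogLink s t → Prop}
  (lat : LGPGaussianLogThetaLattice LogLink IsFull)
  {Frd : Type} {IsoF : Frd → Frd → Type} {Ob : Frd → Type} {realify : Frd → Frd} {Strip : Type}
  {IsoS : Strip → Strip → Type} {Mv : ∀ v : (thetaIndex X).V, v ∈ (thetaIndex X).Vbad → Type}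
  [∀ v h, Monoid (Mv v h)]
  (sig : GlobalLGPFrobenioidSignature (thetaIndex X).lstar (thetaIndex X).V (· ∈ (thetaIndex X).Vbad)
    Frd IsoF Ob realify Strip IsoS Mv)
  (split : SplittingMonoids Mv) {ObΔ : Type} {N : ∀ v : (thetaIndex X).V, v ∈ (thetaIndex X).Vbad → Type}
  [∀ v h, Monoid (N v h)] (qData : QPilotData ObΔ N)
  (t : ∀ (pp : Nat.Primes) (_ : Fin X.lstar) (x : (thetaIndex X).Fibre (.inr pp)),
    haveI : Fact (pp : ℕ).Prime := ⟨pp.2⟩; kOf X pp.1 x)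
  (tq : ∀ (pp : Nat.Primes) (x : (thetaIndex X).Fibre (.inr pp)), haveI : Fact (pp : ℕ).Prime := ⟨pp.2⟩; kOf X pp.1 x)
  (ρ : (∀ v : (thetaIndex X).V, v ∈ (thetaIndex X).Vbad → Set ((logShellsDH X logv).StarPacket v)) →
    ∀ (j : (thetaIndex X).Label) (vQ : (thetaIndex X).VQ), Set ((logShellsDH X logv).Packet j vQ))
  (qK : ∀ v : (thetaIndex X).V, v ∈ (thetaIndex X).Vbad → Set ((logShellsDH X logv).StarPacket v))
  (ht0 : ∀ pp i x, t pp i x ≠ 0)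
  (ht : ∀ (pp : Nat.Primes) (i : Fin X.lstar) (x : (thetaIndex X).Fibre (.inr pp)),
    haveI : Fact (pp : ℕ).Prime := ⟨pp.2⟩
    Real.log ‖t pp i x‖ = -(X.thetaPilot i (placeOf X pp.1 x)) * logNorm F (placeOf X pp.1 x) /
      localDegree F (placeOf X pp.1 x))
  (htq0 : ∀ pp x, tq pp x ≠ 0)
  (htq1 : ∀ (pp : Nat.Primes) (x : (thetaIndex X).Fibre (.inr pp)),
    haveI : Fact (pp : ℕ).Prime := ⟨pp.2⟩; placeOf X pp.1 x ∉ X.S → ‖tq pp x‖ = 1)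
  (htq : ∀ (pp : Nat.Primes) (x : (thetaIndex X).Fibre (.inr pp)),
    haveI : Fact (pp : ℕ).Prime := ⟨pp.2⟩
    Real.log ‖tq pp x‖ = -(X.qPilot (placeOf X pp.1 x)) * logNorm F (placeOf X pp.1 x) /
      localDegree F (placeOf X pp.1 x))

include ht0 ht htq in
/-- **The ORDER variant at the fourth corner ⟺ `−deĝ̲(P_q) ≤ −deĝ̲_lgp(P_Θ) + 𝔼_j |S^±_{j+1}|·log π`** (Θ- and `q`-ideles realising `P_Θ`, `P_q`): every
global possible image has procession volume `−deĝ̲_lgp(P_Θ) + 𝔼_j |S^±_{j+1}|·log π` (`RLana91ArchCorner.processionNormalized_imageChoice_settingPrVolArchSharp`),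
`−|log(q)| = −deĝ̲(P_q)` (abc-iut-c312-7 `negLogQ_settingPrVolArchSharp`), and global possible images exist (`imageChoice_nonempty`).
[cite: DupuyHilado2025, §3.4, Thm. 3.10.1] [cite: Mochizuki2012, IUTchIV Thm. 1.10 proof Step (vii) p. 30] -/
theorem orderVariant_settingPrVolArchSharp_iff :
    OrderVariant
      (LatticeSituation.ofShells (logShellsDH X logv) M archPk archSub (summandPiecesPrArch X hlog hc).Adm
        (summandPiecesPrArch X hlog hc).logvol Ψ act Mmod region frobAdm frobLogvol frobΨ frobMmod unitImage ballImage thetaDiv)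
      (settingPrVolArchSharp X hlog hc M archPk archSub Ψ act Mmod region n lat sig split qData t tq htq0 htq1) ρ qK ↔
      -FinDivisor.ndeg F X.qPilot ≤
        -LgpDivisor.ndegLgp X.thetaPilot +
          processionNormalized (fun i : Fin (thetaIndex X).lstar =>
            (Fintype.card ((thetaIndex X).Caps (Setting.labelSucc i)) : ℝ) * Real.log Real.pi) := by
  have hq := negLogQ_settingPrVolArchSharp X hlog hc M archPk archSub Ψ act Mmod region n lat sig split qData t tq htq0 htq1 htq
  constructor
  · rintro ⟨U, hU⟩
    have hU' := processionNormalized_imageChoice_settingPrVolArchSharp X hlog hc M archPk archSub Ψ act Mmod region n lat sig split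
      qData t tq ht0 ht htq0 htq1 U
    calc -FinDivisor.ndeg F X.qPilot
        = (settingPrVolArchSharp X hlog hc M archPk archSub Ψ act Mmod region n lat sig split qData t tq htq0 htq1).negLogQ := hq.symm
      _ ≤ processionNormalized (fun i : Fin (thetaIndex X).lstar => ∑ᶠ vQ : (thetaIndex X).VQ,
            ((situationDHVolPrArch X hlog hc M archPk archSub Ψ act Mmod region).D n).logvol (Setting.labelSucc i) vQ
              (U.1 (i, vQ))) := hU
      _ = _ := hU'
  · intro h
    obtain ⟨U⟩ := imageChoice_nonempty
      (settingPrVolArchSharp X hlog hc M archPk archSub Ψ act Mmod region n lat sig split qData t tq htq0 htq1)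
    refine ⟨U, ?_⟩
    calc (settingPrVolArchSharp X hlog hc M archPk archSub Ψ act Mmod region n lat sig split qData t tq htq0 htq1).negLogQ
        = -FinDivisor.ndeg F X.qPilot := hq
      _ ≤ _ := h
      _ = processionNormalized (fun i : Fin (thetaIndex X).lstar => ∑ᶠ vQ : (thetaIndex X).VQ,
            ((situationDHVolPrArch X hlog hc M archPk archSub Ψ act Mmod region).D n).logvol (Setting.labelSucc i) vQ
              (U.1 (i, vQ))) :=
        (processionNormalized_imageChoice_settingPrVolArchSharp X hlog hc M archPk archSub Ψ act Mmod region n lat sig split qData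
          t tq ht0 ht htq0 htq1 U).symm

include ht0 ht htq in
/-- **… ⟺ the SHALLOW regime `((l+1)/24 − 1/(2l))·deĝ̲(𝔮) ≤ ((l+5)/4)·log π`** (abc-iut-w5-d241 `archCornerIneq_iff_shallow`: the pilot-degree gap
against abc-iut-S2's archimedean constant). [cite: DupuyHilado2025, Def. 3.1.1, §3.3] [cite: Mochizuki2012, IUTchIV Thm. 1.10 proof Step (vii) p. 30] -/
theorem orderVariant_settingPrVolArchSharp_iff_shallow :
    OrderVariant
      (LatticeSituation.ofShells (logShellsDH X logv) M archPk archSub (summandPiecesPrArch X hlog hc).Adm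
        (summandPiecesPrArch X hlog hc).logvol Ψ act Mmod region frobAdm frobLogvol frobΨ frobMmod unitImage ballImage thetaDiv)
      (settingPrVolArchSharp X hlog hc M archPk archSub Ψ act Mmod region n lat sig split qData t tq htq0 htq1) ρ qK ↔
      (((X.l : ℝ) + 1) / 24 - 1 / (2 * (X.l : ℝ))) * FinDivisor.ndeg F X.qDivisor ≤ ThetaVolumeInput.archLogTheta X.l := by
  rw [orderVariant_settingPrVolArchSharp_iff X hlog hc M archPk archSub Ψ act Mmod region frobAdm frobLogvol frobΨ frobMmod unitImage
    ballImage thetaDiv n lat sig split qData t tq ρ qK ht0 ht htq0 htq1 htq]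
  exact archCornerIneq_iff_shallow X

include ht0 ht htq in
/-- **… ⟺ TEAM B's named input `GlobalVolumeTransport` at the fourth corner**: the LANA-family order variant (over ARBITRARY global possible images)
and the cell's own (xi-g) transport input (over Kummer images at chosen lattice positions) are ONE predicate at this bed — both are the shallow
regime (abc-iut-w5-d241 `globalVolumeTransport_settingPrVolArchSharp_iff_shallow`). [claim: Mochizuki2012, status: disputed] for the quoted setting;
[cite: Mochizuki2012, IUTchIII Cor. 3.12 proof Step (xi) p. 184] -/
theorem orderVariant_settingPrVolArchSharp_iff_globalVolumeTransport :
    OrderVariant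
      (LatticeSituation.ofShells (logShellsDH X logv) M archPk archSub (summandPiecesPrArch X hlog hc).Adm
        (summandPiecesPrArch X hlog hc).logvol Ψ act Mmod region frobAdm frobLogvol frobΨ frobMmod unitImage ballImage thetaDiv)
      (settingPrVolArchSharp X hlog hc M archPk archSub Ψ act Mmod region n lat sig split qData t tq htq0 htq1) ρ qK ↔
      GlobalVolumeTransport (settingPrVolArchSharp X hlog hc M archPk archSub Ψ act Mmod region n lat sig split qData t tq htq0 htq1) := by
  rw [orderVariant_settingPrVolArchSharp_iff_shallow X hlog hc M archPk archSub Ψ act Mmod region frobAdm frobLogvol frobΨ frobMmod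
    unitImage ballImage thetaDiv n lat sig split qData t tq ρ qK ht0 ht htq0 htq1 htq,
    globalVolumeTransport_settingPrVolArchSharp_iff_shallow X hlog hc M archPk archSub Ψ act Mmod region n lat sig split qData t tq ht0
      ht htq0 htq1 htq]

include ht0 ht htq in
/-- **HOLDS-AS-TYPED on SHALLOW pilot data** (regime inhabited over every number field: abc-iut-w5-d241 `shallow_pilotData_deepAt_two_five_one`,
`(p, l, N) = (2, 5, 1)`). A statement about w5-d163's MODEL of the `∞`-container; holds-as-typed ≠ holds-in-print. [cite: DupuyHilado2025, §3.3] -/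
theorem orderVariant_settingPrVolArchSharp_of_shallow
    (hsh : (((X.l : ℝ) + 1) / 24 - 1 / (2 * (X.l : ℝ))) * FinDivisor.ndeg F X.qDivisor ≤ ThetaVolumeInput.archLogTheta X.l) :
    OrderVariant
      (LatticeSituation.ofShells (logShellsDH X logv) M archPk archSub (summandPiecesPrArch X hlog hc).Adm
        (summandPiecesPrArch X hlog hc).logvol Ψ act Mmod region frobAdm frobLogvol frobΨ frobMmod unitImage ballImage thetaDiv)
      (settingPrVolArchSharp X hlog hc M archPk archSub Ψ act Mmod region n lat sig split qData t tq htq0 htq1) ρ qK :=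
  (orderVariant_settingPrVolArchSharp_iff_shallow X hlog hc M archPk archSub Ψ act Mmod region frobAdm frobLogvol frobΨ frobMmod unitImage
    ballImage thetaDiv n lat sig split qData t tq ρ qK ht0 ht htq0 htq1 htq).2 hsh

include ht0 ht htq in
/-- **KILLED-AS-TYPED on DEEP pilot data** (regime inhabited over every number field: abc-iut-w5-d241 `not_shallow_pilotData_deepAt_two_five_three`,
`(p, l, N) = (2, 5, 3)`; `exists_pilotData_deepAt_not_shallow` for every base, prime and `l`). [cite: DupuyHilado2025, §3.3] -/
theorem not_orderVariant_settingPrVolArchSharp_of_deep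
    (hdeep : ¬ (((X.l : ℝ) + 1) / 24 - 1 / (2 * (X.l : ℝ))) * FinDivisor.ndeg F X.qDivisor ≤ ThetaVolumeInput.archLogTheta X.l) :
    ¬ OrderVariant
      (LatticeSituation.ofShells (logShellsDH X logv) M archPk archSub (summandPiecesPrArch X hlog hc).Adm
        (summandPiecesPrArch X hlog hc).logvol Ψ act Mmod region frobAdm frobLogvol frobΨ frobMmod unitImage ballImage thetaDiv)
      (settingPrVolArchSharp X hlog hc M archPk archSub Ψ act Mmod region n lat sig split qData t tq htq0 htq1) ρ qK := fun h =>
  hdeep ((orderVariant_settingPrVolArchSharp_iff_shallow X hlog hc M archPk archSub Ψ act Mmod region frobAdm frobLogvol frobΨ frobMmod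
    unitImage ballImage thetaDiv n lat sig split qData t tq ρ qK ht0 ht htq0 htq1 htq).1 h)

include ht0 ht htq in
/-- **At the fourth corner the order variant is STRICTLY weaker than (9-1) as typed on shallow data**: (9-1) fails there
(`RLana91ArchCorner.not_H_settingPrVolArchSharp`, transcendence of `π`) while the order variant holds (`orderVariant_settingPrVolArchSharp_of_shallow`) —
the genuine-bed twin of gen 2's toy-model separation `RLana91OrderVariant.orderVariant_shell_two_and_not_H`. [cite: DupuyHilado2025, §3.3]
[cite: Lindemann1882, via BakerTNT1975 Ch. 1 Theorem 1.3, p. 5] -/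
theorem orderVariant_and_not_H_settingPrVolArchSharp_of_shallow
    (hsh : (((X.l : ℝ) + 1) / 24 - 1 / (2 * (X.l : ℝ))) * FinDivisor.ndeg F X.qDivisor ≤ ThetaVolumeInput.archLogTheta X.l) :
    OrderVariant
        (LatticeSituation.ofShells (logShellsDH X logv) M archPk archSub (summandPiecesPrArch X hlog hc).Adm
          (summandPiecesPrArch X hlog hc).logvol Ψ act Mmod region frobAdm frobLogvol frobΨ frobMmod unitImage ballImage thetaDiv)
        (settingPrVolArchSharp X hlog hc M archPk archSub Ψ act Mmod region n lat sig split qData t tq htq0 htq1) ρ qK ∧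
      ¬ Repair.CandLana1.H
        (LatticeSituation.ofShells (logShellsDH X logv) M archPk archSub (summandPiecesPrArch X hlog hc).Adm
          (summandPiecesPrArch X hlog hc).logvol Ψ act Mmod region frobAdm frobLogvol frobΨ frobMmod unitImage ballImage thetaDiv)
        (settingPrVolArchSharp X hlog hc M archPk archSub Ψ act Mmod region n lat sig split qData t tq htq0 htq1) ρ qK :=
  ⟨orderVariant_settingPrVolArchSharp_of_shallow X hlog hc M archPk archSub Ψ act Mmod region frobAdm frobLogvol frobΨ frobMmod unitImage
      ballImage thetaDiv n lat sig split qData t tq ρ qK ht0 ht htq0 htq1 htq hsh,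
    not_H_settingPrVolArchSharp X hlog hc M archPk archSub Ψ act Mmod region frobAdm frobLogvol frobΨ frobMmod unitImage ballImage
      thetaDiv n lat sig split qData t tq ρ qK ht0 ht htq0 htq1 htq⟩

end GenuineArch

end Summit.ABC.IUTFork.Repair.RLana91OrderVariantArchCorner

end
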